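import Summits.BirchSwinnertonDyer.BirchSwinnertonDyer.Theorems.AlignedTransportAtTwoMainConjectureTransportAlignedAtTwoDeltaPosJacobianLevel
import HarnessLib

/-!
# Crux C1 `MainConjectureTransportAlignedAtTwo` (stmt-BirchSwinnertonDyer-22296), line `birth`, residual (R2) `stub_lamLawKilford` (Kilford stratum):
# SAME DEPLETED COPY ⟹ TRANSPORT AT A DEPLETED LEVEL, CARRIER-AGNOSTIC — two abstract `ℚ`-rational maps `Φᵢ : J₀(L) → Wᵢ(ℂ)` with the SAME KERNEL on
# the half-classes `[x/2]` transport them to `2`-torsion points that differ by THE equivariant isomorphism (width seat att-p3 g15; `--supports 22296`)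

THEOREMS ONLY (no `def`, no `sorry`, no named fact). CONDITIONAL on abstract Galois data (hypotheses `gal`, `hgal₁`, `hgal₂`, the shape of
`ModularJacobianGaloisData.jacobiMap_galAct` / T1⁺) and on the SAME-KERNEL hypothesis `hker`. BSD is not proved by this; C1 is not closed by this.

This is att-p3 g14's `…DeltaPosJacobianLevel.half_transport_of_abstract` (p669108) with its four-coset input — Buzzard's mod-`2` multiplicity one + Hecke
self-duality, `…BuzzardKFour.fourCosets_of_dvd_S3`, hence the hypotheses `hSD hBz`, `Δ(W₁) ∉ ℚ₂²` (OFF the Kilford stratum), `L` odd, `N₁∏ℓ² ∣ L`,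
`primes(L) ⊆ S`, good reduction off `2L`, the Hecke-kernel relations `hTᵢ hUᵢ` and `hnz₂` — REPLACED by the single hypothesis
`hker : ∀ x ∈ Λ_L, Φ₁ [x/2] = 0 ↔ Φ₂ [x/2] = 0` («the two depleted copies in `J₀(L)[2]` coincide» read through the maps; for the cross-level
depleted maps `Φᵢ = θᵢ ∘ Σ_d ε_{d,i} δ_{d*}` this is the mechanism of the cell's IMC-SYMB-Σ, MEMO-imc §10.21 (c′), census 770/770). As at the
conductor level (`…KilfordCopyTransport`, p672990) the common kernel IS `ker θ₁`, of index `#W₁[2] = 4` by surjectivity — no multiplicity one, valid ON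
the stratum:

* **`half_transport_of_abstract_of_ker_iff`** — `Φ₂ [x/2] = ι (e P₁)` whenever `Φ₁ [x/2] = ι P₁`, `e` THE equivariant iso of the shared cubic field;
* `half_transport_link_of_ker_iff` — the link currency `∃ P, ι P = u₁(c₁·D_S·x(g₁)/2) ∧ ι (e P) = u₂(c₂·D_S·x(g₂)/2)` consumed by the depleted parity
  links (`…DeltaPosParityLinkDepleted.even_depletedPlusValue_iff_of_link` for `Δ > 0`; this seat's rhombic twin for `Δ < 0`).

References: Darmon–Diamond–Taylor 1995 §1.3, §1.5, §1.7 [DarmonDiamondTaylor1995]; Kilford–Wiese 2008 Thm. 1.1, Question 1.9 [KilfordWiese2008];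
Emerton–Pollack–Weston 2006 §3 (depletion) [EmertonPollackWeston2006]; Silverman AEC III.§7 [SilvermanAEC2009].
-/

noncomputable section

-- justification: the `Summit.BirchSwinnertonDyer.BirchSwinnertonDyer.…` path repeats a component (route-file convention)
set_option linter.dupNamespace false
set_option autoImplicit false

open scoped MatrixGroups ModularForm NumberField Classical
open CongruenceSubgroup Complex WeierstrassCurve IsDedekindDomain Polynomial Module
open Literature.NumberTheory.EllipticCurves Literature.NumberTheory.EllipticCurves.ModularForms
open Literature.NumberTheory.EllipticCurves.Greenberg1999
open Summit.BirchSwinnertonDyer.Rank1Residual.F1Sign2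
open Summit.BirchSwinnertonDyer.BirchSwinnertonDyer.Theorems.AlignedTransportAtTwoDeltaPosGaloisPlane
open Summit.BirchSwinnertonDyer.BirchSwinnertonDyer.Theorems.AlignedTransportAtTwoDeltaPosJacobian
open Summit.BirchSwinnertonDyer.BirchSwinnertonDyer.Theorems.AlignedTransportAtTwoDeltaPosJacobianLevel

namespace Summit.BirchSwinnertonDyer.BirchSwinnertonDyer.Theorems.AlignedTransportAtTwoKilfordCopyTransportLevel

section Transport

variable {L : ℕ} [NeZero L] (ι : AlgebraicClosure ℚ →+* ℂ)

/-- **SAME DEPLETED COPY ⟹ TRANSPORT, carrier-agnostic.** Abstract additive `Φᵢ : J₀(L) → Wᵢ(ℂ)` of curves `W₁ W₂` without rational `2`-torsion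
abscissa, `Δ(W₂) ∉ ℚ²`, sharing a cubic field `F ∋ r₁, r₂`; an abstract Galois action `gal` on `J₀(L)_tors` making both `Φᵢ` equivariant on torsion
(`hgalᵢ`); `Φ₁ ≠ 0` on some half-class; and the SAME KERNEL of `Φ₁, Φ₂` on half-classes. Then `Φ₁ [x/2] = ι P₁ ⟹ Φ₂ [x/2] = ι (e P₁)`, `e` THE
`Γ_ℚ`-equivariant isomorphism `W₁[2] ≃+ W₂[2]`. [cite: DarmonDiamondTaylor1995, §1.5 and §1.7] [cite: KilfordWiese2008, Thm. 1.1 and Question 1.9] -/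
theorem half_transport_of_abstract_of_ker_iff
    {W₁ W₂ : WeierstrassCurve ℚ} [W₁.IsElliptic] [W₂.IsElliptic]
    (ht₁ : ∀ x : ℚ, ¬ HasRationalTwoTorsionX W₁ x) (ht₂ : ∀ x : ℚ, ¬ HasRationalTwoTorsionX W₂ x) (hΔ₂ : ¬ IsSquare W₂.Δ)
    {F : Type*} [Field F] [Algebra ℚ F] [FiniteDimensional ℚ F] (hF : finrank ℚ F = 3)
    {r₁ r₂ : F} (hr₁ : aeval r₁ (twoDivisionUCubic W₁) = 0) (hr₂ : aeval r₂ (twoDivisionUCubic W₂) = 0)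
    (Φ₁ : J0 L →+ (W₁.baseChange ℂ).toAffine.Point) (Φ₂ : J0 L →+ (W₂.baseChange ℂ).toAffine.Point)
    (gal : Field.absoluteGaloisGroup ℚ → (J0.tors L →+ J0.tors L))
    (hgal₁ : ∀ (σ : Field.absoluteGaloisGroup ℚ) (y : J0.tors L) (P : W₁.geomPoints),
      Φ₁ (y : J0 L) = W₁.geomPointsToComplex ι P → Φ₁ ((gal σ y : J0.tors L) : J0 L) = W₁.geomPointsToComplex ι (σ • P))
    (hgal₂ : ∀ (σ : Field.absoluteGaloisGroup ℚ) (y : J0.tors L) (P : W₂.geomPoints),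
      Φ₂ (y : J0 L) = W₂.geomPointsToComplex ι P → Φ₂ ((gal σ y : J0.tors L) : J0 L) = W₂.geomPointsToComplex ι (σ • P))
    (hnz₁ : ∃ x ∈ periodHomology L, Φ₁ (Submodule.Quotient.mk ((2 : ℂ)⁻¹ • x)) ≠ 0)
    (hker : ∀ x ∈ periodHomology L,
      Φ₁ (Submodule.Quotient.mk ((2 : ℂ)⁻¹ • x)) = 0 ↔ Φ₂ (Submodule.Quotient.mk ((2 : ℂ)⁻¹ • x)) = 0)
    (e : geomTorsion W₁ (2 : ℤ) ≃+ geomTorsion W₂ (2 : ℤ))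
    (he : ∀ (σ : Field.absoluteGaloisGroup ℚ) (P : geomTorsion W₁ (2 : ℤ)), e (σ • P) = σ • e P)
    {x : Module.Dual ℂ (CuspForm (Gamma0 L) 2)} (hx : x ∈ periodHomology L) {P₁ : geomTorsion W₁ (2 : ℤ)}
    (hP₁ : Φ₁ (Submodule.Quotient.mk ((2 : ℂ)⁻¹ • x)) = W₁.geomPointsToComplex ι (P₁ : W₁.geomPoints)) :
    Φ₂ (Submodule.Quotient.mk ((2 : ℂ)⁻¹ • x)) = W₂.geomPointsToComplex ι ((e P₁ : geomTorsion W₂ (2 : ℤ)) : W₂.geomPoints) := by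
  -- notation
  set Λ := periodHomology L with hΛ
  let half : Module.Dual ℂ (CuspForm (Gamma0 L) 2) → J0 L := fun z ↦ Submodule.Quotient.mk ((2 : ℂ)⁻¹ • z)
  have half_add : ∀ z z', half (z + z') = half z + half z' := fun z z' ↦ by
    simp only [half, smul_add, Submodule.Quotient.mk_add]
  -- the maps `θᵢ : Λ → Wᵢ[2]` through `existsUnique_geomTorsion_eq`
  have hex₁ : ∀ z : Λ, ∃! P : geomTorsion W₁ (2 : ℤ), W₁.geomPointsToComplex ι (P : W₁.geomPoints) = Φ₁ (half z) :=
    fun z ↦ existsUnique_geomTorsion_eq W₁ ι (apply_half_add_self Φ₁ z.2)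
  have hex₂ : ∀ z : Λ, ∃! P : geomTorsion W₂ (2 : ℤ), W₂.geomPointsToComplex ι (P : W₂.geomPoints) = Φ₂ (half z) :=
    fun z ↦ existsUnique_geomTorsion_eq W₂ ι (apply_half_add_self Φ₂ z.2)
  choose θ₁f hθ₁f using fun z ↦ (hex₁ z).exists
  choose θ₂f hθ₂f using fun z ↦ (hex₂ z).exists
  have uniq₁ : ∀ (z : Λ) (P : geomTorsion W₁ (2 : ℤ)), W₁.geomPointsToComplex ι (P : W₁.geomPoints) = Φ₁ (half z) → P = θ₁f z :=
    fun z P hP ↦ (hex₁ z).unique hP (hθ₁f z)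
  have uniq₂ : ∀ (z : Λ) (P : geomTorsion W₂ (2 : ℤ)), W₂.geomPointsToComplex ι (P : W₂.geomPoints) = Φ₂ (half z) → P = θ₂f z :=
    fun z P hP ↦ (hex₂ z).unique hP (hθ₂f z)
  let θ₁ : Λ →+ geomTorsion W₁ (2 : ℤ) :=
    { toFun := θ₁f
      map_zero' := by
        symm; apply uniq₁
        have h0 : half 0 = 0 := by simp only [half, smul_zero, Submodule.Quotient.mk_zero]
        rw [ZeroMemClass.coe_zero, map_zero, ZeroMemClass.coe_zero, h0, map_zero]
      map_add' := fun z z' ↦ by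
        symm; apply uniq₁
        rw [AddSubgroup.coe_add, map_add, hθ₁f, hθ₁f, AddSubgroup.coe_add, half_add, map_add] }
  let θ₂ : Λ →+ geomTorsion W₂ (2 : ℤ) :=
    { toFun := θ₂f
      map_zero' := by
        symm; apply uniq₂
        have h0 : half 0 = 0 := by simp only [half, smul_zero, Submodule.Quotient.mk_zero]
        rw [ZeroMemClass.coe_zero, map_zero, ZeroMemClass.coe_zero, h0, map_zero]
      map_add' := fun z z' ↦ by
        symm; apply uniq₂
        rw [AddSubgroup.coe_add, map_add, hθ₂f, hθ₂f, AddSubgroup.coe_add, half_add, map_add] }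
  have hθ₁_apply : ∀ z, θ₁ z = θ₁f z := fun _ ↦ rfl
  have hθ₂_apply : ∀ z, θ₂ z = θ₂f z := fun _ ↦ rfl
  -- kernels in `Φ` currency
  have hker₁ : ∀ z : Λ, θ₁ z = 0 ↔ Φ₁ (half z) = 0 := by
    intro z
    constructor
    · intro h
      have := hθ₁f z
      rw [← hθ₁_apply, h, ZeroMemClass.coe_zero, map_zero] at this
      exact this.symm
    · intro h
      rw [hθ₁_apply]; symm; apply uniq₁
      rw [ZeroMemClass.coe_zero, map_zero]; exact h.symm
  have hker₂ : ∀ z : Λ, θ₂ z = 0 ↔ Φ₂ (half z) = 0 := by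
    intro z
    constructor
    · intro h
      have := hθ₂f z
      rw [← hθ₂_apply, h, ZeroMemClass.coe_zero, map_zero] at this
      exact this.symm
    · intro h
      rw [hθ₂_apply]; symm; apply uniq₂
      rw [ZeroMemClass.coe_zero, map_zero]; exact h.symm
  have hkk : ∀ z : Λ, θ₁ z = 0 ↔ θ₂ z = 0 := fun z ↦ by
    rw [hker₁, hker₂]; exact hker z z.2
  -- the torsion points `⟨half z⟩ ∈ J0.tors L` and the lifted Galois action on `Λ`
  have htors : ∀ z : Λ, half z ∈ J0.tors L := fun z ↦ by
    rw [J0.mem_tors_iff, isOfFinAddOrder_iff_nsmul_eq_zero]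
    exact ⟨2, two_pos, by rw [two_nsmul]; exact half_add_half_eq_zero z.2⟩
  have hlift : ∀ (σ : Field.absoluteGaloisGroup ℚ) (z : Λ), ∃ z' : Λ,
      half z' = ((gal σ ⟨half z, htors z⟩ : J0.tors L) : J0 L) := by
    intro σ z
    set t : J0.tors L := gal σ ⟨half z, htors z⟩ with ht
    have htt : (t : J0 L) + (t : J0 L) = 0 := by
      rw [← Submodule.coe_add, ht, ← map_add]
      have : (⟨half z, htors z⟩ : J0.tors L) + ⟨half z, htors z⟩ = 0 := Subtype.ext (half_add_half_eq_zero z.2)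
      rw [this, map_zero, Submodule.coe_zero]
    obtain ⟨z', hz', hz'eq⟩ := exists_half_eq htt
    exact ⟨⟨z', hz'⟩, hz'eq⟩
  choose act hact using hlift
  -- equivariance
  have hθ₁ : ∀ (σ : Field.absoluteGaloisGroup ℚ) (z : Λ), θ₁ (act σ z) = σ • θ₁ z := by
    intro σ z
    symm
    rw [hθ₁_apply, hθ₁_apply]
    apply uniq₁
    rw [AddSubgroup.torsionBy.coe_smul, hact σ z]
    exact (hgal₁ σ ⟨half z, htors z⟩ (θ₁f z : W₁.geomPoints) (hθ₁f z).symm).symm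
  have hθ₂ : ∀ (σ : Field.absoluteGaloisGroup ℚ) (z : Λ), θ₂ (act σ z) = σ • θ₂ z := by
    intro σ z
    symm
    rw [hθ₂_apply, hθ₂_apply]
    apply uniq₂
    rw [AddSubgroup.torsionBy.coe_smul, hact σ z]
    exact (hgal₂ σ ⟨half z, htors z⟩ (θ₂f z : W₂.geomPoints) (hθ₂f z).symm).symm
  -- non-vanishing of `θ₁`, and of `θ₂` through the same kernel
  have h0₁ : ∃ z, θ₁ z ≠ 0 := by
    obtain ⟨z, hz, hne⟩ := hnz₁
    exact ⟨⟨z, hz⟩, fun h0 ↦ hne ((hker₁ ⟨z, hz⟩).mp h0)⟩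
  have h0₂ : ∃ z, θ₂ z ≠ 0 := by
    obtain ⟨z, hz⟩ := h0₁
    exact ⟨z, fun h0 ↦ hz ((hkk z).mpr h0)⟩
  -- the common kernel IS `ker θ₁`, of index `4` by surjectivity onto `W₁[2]`
  set K : AddSubgroup Λ := θ₁.ker with hK
  have hK₁ : K ≤ θ₁.ker := le_rfl
  have hK₂ : K ≤ θ₂.ker := fun z hz ↦ by
    rw [AddMonoidHom.mem_ker] at hz ⊢
    exact (hkk z).mp hz
  have hsurj₁ := surjective_of_equivariant_of_exists_ne_zero ht₁ act θ₁ hθ₁ h0₁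
  have hidx : K.index = 4 := by
    rw [hK, AddSubgroup.index_ker, AddMonoidHom.range_eq_top.mpr hsurj₁, AddSubgroup.card_top]
    exact WeierstrassCurve.natCard_geomTorsion_two W₁
  -- the factorisation through THE equivariant isomorphism
  have hcomp := comp_eq_of_sharedCubicField (W₁ := W₁) (W₂ := W₂) hF ht₁ ht₂ hΔ₂ hr₁ hr₂ act θ₁ θ₂ hθ₁ hθ₂ h0₁ h0₂
    K hK₁ hK₂ (by rw [hidx]; norm_num) (by rw [hidx]) e he
  -- conclude at `x`
  have hP₁' : P₁ = θ₁f ⟨x, hx⟩ := uniq₁ ⟨x, hx⟩ P₁ hP₁.symm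
  have := hθ₂f ⟨x, hx⟩
  rw [← hθ₂_apply, hcomp ⟨x, hx⟩, hθ₁_apply, ← hP₁'] at this
  exact this.symm

/-- Under the same-kernel hypothesis, non-vanishing of one abstract map on a half-class is non-vanishing of the other. [folklore] -/
theorem exists_apply_half_ne_zero_of_ker_iff {B₁ B₂ : Type*} [AddCommGroup B₁] [AddCommGroup B₂] (Φ₁ : J0 L →+ B₁) (Φ₂ : J0 L →+ B₂)
    (hker : ∀ x ∈ periodHomology L,
      Φ₁ (Submodule.Quotient.mk ((2 : ℂ)⁻¹ • x)) = 0 ↔ Φ₂ (Submodule.Quotient.mk ((2 : ℂ)⁻¹ • x)) = 0)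
    (hnz₁ : ∃ x ∈ periodHomology L, Φ₁ (Submodule.Quotient.mk ((2 : ℂ)⁻¹ • x)) ≠ 0) :
    ∃ x ∈ periodHomology L, Φ₂ (Submodule.Quotient.mk ((2 : ℂ)⁻¹ • x)) ≠ 0 := by
  obtain ⟨x, hx, hne⟩ := hnz₁
  exact ⟨x, hx, fun h ↦ hne ((hker x hx).mpr h)⟩

/-- **The link currency at a depleted level.** With the maps `Φᵢ` reading on half-classes as `Φᵢ [x/2] = uᵢ(cᵢ·D_S·x(gᵢ)/2)` (hypotheses `hΦ₁ hΦ₂`, the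
shape of `ModularParametrizationData.jacobiMapForm_mk` for the forms `D_S·gᵢ`), every `x ∈ Λ_L` carries the link
`∃ P, ι P = u₁(c₁·D_S·x(g₁)/2) ∧ ι (e P) = u₂(c₂·D_S·x(g₂)/2)`. [cite: DarmonDiamondTaylor1995, §1.5 and §1.7] -/
theorem half_transport_link_of_ker_iff
    {W₁ W₂ : WeierstrassCurve ℚ} [W₁.IsElliptic] [W₂.IsElliptic]
    (ht₁ : ∀ x : ℚ, ¬ HasRationalTwoTorsionX W₁ x) (ht₂ : ∀ x : ℚ, ¬ HasRationalTwoTorsionX W₂ x) (hΔ₂ : ¬ IsSquare W₂.Δ)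
    {N₁ N₂ : ℕ} [NeZero N₁] [NeZero N₂] (D₁ : ModularParametrizationData W₁ N₁) (D₂ : ModularParametrizationData W₂ N₂)
    (S : Finset ℕ)
    {F : Type*} [Field F] [Algebra ℚ F] [FiniteDimensional ℚ F] (hF : finrank ℚ F = 3)
    {r₁ r₂ : F} (hr₁ : aeval r₁ (twoDivisionUCubic W₁) = 0) (hr₂ : aeval r₂ (twoDivisionUCubic W₂) = 0)
    (g₁ g₂ : CuspForm (Gamma0 L) 2)
    (Φ₁ : J0 L →+ (W₁.baseChange ℂ).toAffine.Point) (Φ₂ : J0 L →+ (W₂.baseChange ℂ).toAffine.Point)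
    (hΦ₁ : ∀ x ∈ periodHomology L, Φ₁ (Submodule.Quotient.mk ((2 : ℂ)⁻¹ • x)) =
      D₁.uniformize ((D₁.c : ℂ) * (((∏ ℓ ∈ S, ℓ ^ 2 : ℕ) : ℂ) * x g₁) / 2))
    (hΦ₂ : ∀ x ∈ periodHomology L, Φ₂ (Submodule.Quotient.mk ((2 : ℂ)⁻¹ • x)) =
      D₂.uniformize ((D₂.c : ℂ) * (((∏ ℓ ∈ S, ℓ ^ 2 : ℕ) : ℂ) * x g₂) / 2))
    (gal : Field.absoluteGaloisGroup ℚ → (J0.tors L →+ J0.tors L))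
    (hgal₁ : ∀ (σ : Field.absoluteGaloisGroup ℚ) (y : J0.tors L) (P : W₁.geomPoints),
      Φ₁ (y : J0 L) = W₁.geomPointsToComplex ι P → Φ₁ ((gal σ y : J0.tors L) : J0 L) = W₁.geomPointsToComplex ι (σ • P))
    (hgal₂ : ∀ (σ : Field.absoluteGaloisGroup ℚ) (y : J0.tors L) (P : W₂.geomPoints),
      Φ₂ (y : J0 L) = W₂.geomPointsToComplex ι P → Φ₂ ((gal σ y : J0.tors L) : J0 L) = W₂.geomPointsToComplex ι (σ • P))
    (hnz₁ : ∃ x ∈ periodHomology L, Φ₁ (Submodule.Quotient.mk ((2 : ℂ)⁻¹ • x)) ≠ 0)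
    (hker : ∀ x ∈ periodHomology L,
      Φ₁ (Submodule.Quotient.mk ((2 : ℂ)⁻¹ • x)) = 0 ↔ Φ₂ (Submodule.Quotient.mk ((2 : ℂ)⁻¹ • x)) = 0)
    (e : geomTorsion W₁ (2 : ℤ) ≃+ geomTorsion W₂ (2 : ℤ))
    (he : ∀ (σ : Field.absoluteGaloisGroup ℚ) (P : geomTorsion W₁ (2 : ℤ)), e (σ • P) = σ • e P)
    {x : Module.Dual ℂ (CuspForm (Gamma0 L) 2)} (hx : x ∈ periodHomology L) :
    ∃ P : geomTorsion W₁ (2 : ℤ),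
      W₁.geomPointsToComplex ι (P : geomPoints W₁) = D₁.uniformize ((D₁.c : ℂ) * (((∏ ℓ ∈ S, ℓ ^ 2 : ℕ) : ℂ) * x g₁) / 2) ∧
      W₂.geomPointsToComplex ι (e P : geomPoints W₂) = D₂.uniformize ((D₂.c : ℂ) * (((∏ ℓ ∈ S, ℓ ^ 2 : ℕ) : ℂ) * x g₂) / 2) := by
  obtain ⟨P₁, hP₁, -⟩ := existsUnique_geomTorsion_eq W₁ ι (apply_half_add_self Φ₁ hx)
  refine ⟨P₁, by rw [hP₁, hΦ₁ x hx], ?_⟩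
  rw [← hΦ₂ x hx]
  exact (half_transport_of_abstract_of_ker_iff ι ht₁ ht₂ hΔ₂ hF hr₁ hr₂ Φ₁ Φ₂ gal hgal₁ hgal₂ hnz₁ hker e he hx hP₁.symm).symm

end Transport

end Summit.BirchSwinnertonDyer.BirchSwinnertonDyer.Theorems.AlignedTransportAtTwoKilfordCopyTransportLevel

end
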